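import Summits.CriticalPhenomena.PercolationContinuityZ3.Theorems.Transplant.SkelPhiWinChainF2
import HarnessLib

/-!
# N1 (the `{±1}` node), (R) column (NEG-SCOPE B.17, y′-family v3): the TARGET CHAIN OVER THREE WINDOWS — a segment of `S₁.N + 1` steps through a planar
# window `𝒲₁`, then `S₂.N + 1` steps through `𝒲₂`, then `S₃.N + 1` steps through `𝒲₃` (three frames of the SAME exploration graph), glued by TWO cross-frame
# containments `𝒲₁.coreTF S₁ S₁.N ⊆ X^{(0)}_0` (segment 2) and `𝒲₂.coreTF S₂ S₂.N ⊆ X^{(0)}_0` (segment 3); the verbatim three-segment twin of p5-g8's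
# `WinChainData.chain₂` (segments 1–2 are glued by `chain₂`, segment 3 is appended at the cut `S₁.N + 1 + S₂.N`)

WHY (located (L-R4), lane INBOX 2026-08-21T19:47Z): for a vertical direction the root residue's y′-run cannot start next to the pinned seed (its first link
regions contain the root); the repaired chain is hop → bridge (frame 1) → x-run prefix (frame 2) → y′-run (frame 3).

builds on p205010 (kernel theorem, internal audit signed; external expert review pending) — nothing in this file uses p205010; nothing here is a
claim about the open node `SamePDropOfSkeletonNeg₁`.
Lane `prim-bschramm`, seat `prim-bschramm-p3` (gen 10; design owner + (R) owner); helper file (`--supports stmt-CriticalPhenomena-4575 --as helper`).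
* §1 `WinChainData.stepAF₃ / coreTF₃` (`ChainPlanar.pw` of `stepAF₂ / coreTF₂` and segment 3 at the cut `S₁.N + 1 + S₂.N`), `…_left/_right`, `stepAF₃_o`;
* §2 **`WinChainData.chain₃`**: the same `∃`-free 7-tuple as `chain₂` on `Fin (S₁.N + 1 + S₂.N + 1 + S₃.N + 1)`, last true target `𝒲₃.coreTF S₃ S₃.N`.
[cite: KozmaNitzan2024, §4 Lemma 11 (pp. 22–23), Lemma 12 (pp. 23–25), p. 20 (Step IV)]
-/

noncomputable section

open MeasureTheory ProbabilityTheory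
open scoped ENNReal

namespace Summit.CriticalPhenomena.PercolationContinuityZ3.Theorems.Transplant

namespace Skelφ

open Literature.Probability.Percolation Literature.Probability.LatticeModels SimpleGraph
open Literature.Probability.Percolation.KozmaNitzan
open KNLevels ChainPlanar

variable {V : Type} [DecidableEq V]

namespace WinChainData

variable {G' : SimpleGraph V} [G'.LocallyFinite]
variable (P₁ P₂ P₃ : WinChainData V) (𝒲₁ 𝒲₂ 𝒲₃ : PlanarWindow G') (S₁ S₂ S₃ : SchedFrame)

/-! ## §1 The three-segment families -/

/-- **The three-segment step family**: `stepAF₂` of segments 1–2, then segment 3 shifted by `S₁.N + 1 + S₂.N + 1`. [cite: KozmaNitzan2024, §4 Lemma 12 (pp. 23–25)] -/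
def stepAF₃ (k : ℕ) : TStep G' := pw (S₁.N + 1 + S₂.N) (fun k => stepAF₂ P₁ P₂ 𝒲₁ 𝒲₂ S₁ S₂ k) (fun k => P₃.stepAF 𝒲₃ S₃ k) k

/-- **The three-segment true-target family.** [cite: KozmaNitzan2024, §4 Lemma 12] -/
def coreTF₃ (k : ℕ) : Finset V := pw (S₁.N + 1 + S₂.N) (fun k => coreTF₂ 𝒲₁ 𝒲₂ S₁ S₂ k) (fun k => 𝒲₃.coreTF S₃ k) k

/-- Segments 1–2 of the step family. [folklore] -/
theorem stepAF₃_left {k : ℕ} (hk : k ≤ S₁.N + 1 + S₂.N) : stepAF₃ P₁ P₂ P₃ 𝒲₁ 𝒲₂ 𝒲₃ S₁ S₂ S₃ k = stepAF₂ P₁ P₂ 𝒲₁ 𝒲₂ S₁ S₂ k := pw_of_le _ _ hk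

/-- Segment 3 of the step family. [folklore] -/
theorem stepAF₃_right (j : ℕ) : stepAF₃ P₁ P₂ P₃ 𝒲₁ 𝒲₂ 𝒲₃ S₁ S₂ S₃ (S₁.N + 1 + S₂.N + 1 + j) = P₃.stepAF 𝒲₃ S₃ j := pw_add _ _ _ _

/-- Segments 1–2 of the true-target family. [folklore] -/
theorem coreTF₃_left {k : ℕ} (hk : k ≤ S₁.N + 1 + S₂.N) : coreTF₃ 𝒲₁ 𝒲₂ 𝒲₃ S₁ S₂ S₃ k = coreTF₂ 𝒲₁ 𝒲₂ S₁ S₂ k := pw_of_le _ _ hk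

/-- Segment 3 of the true-target family. [folklore] -/
theorem coreTF₃_right (j : ℕ) : coreTF₃ 𝒲₁ 𝒲₂ 𝒲₃ S₁ S₂ S₃ (S₁.N + 1 + S₂.N + 1 + j) = 𝒲₃.coreTF S₃ j := pw_add _ _ _ _

/-- The source of every step is `P₁.o` (given `P₂.o = P₁.o`, `P₃.o = P₁.o`). [folklore] -/
theorem stepAF₃_o (ho₂ : P₂.o = P₁.o) (ho₃ : P₃.o = P₁.o) (k : ℕ) : (stepAF₃ P₁ P₂ P₃ 𝒲₁ 𝒲₂ 𝒲₃ S₁ S₂ S₃ k).L.o = P₁.o := by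
  by_cases h : k ≤ S₁.N + 1 + S₂.N
  · rw [stepAF₃_left _ _ _ _ _ _ _ _ _ h]; exact stepAF₂_o P₁ P₂ 𝒲₁ 𝒲₂ S₁ S₂ ho₂ k
  · obtain ⟨j, rfl⟩ : ∃ j, k = S₁.N + 1 + S₂.N + 1 + j := ⟨k - (S₁.N + 1 + S₂.N + 1), by omega⟩
    rw [stepAF₃_right]; exact ho₃

/-! ## §2 The three-window chain -/

/-- **THE TARGET CHAIN OVER THREE WINDOWS.**  Segments `(Pᵢ, 𝒲ᵢ, Sᵢ)`, `i = 1, 2, 3`, in the same exploration graph `G'`, same source; per segment the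
hypotheses of `kitsAt_stepAF` at every step, nonempty true targets, rim parts inside the regions and rim excess `≤ η`; the CROSS LINKS
`𝒲₁.coreTF S₁ S₁.N ⊆ 𝒲₂.W (S₂.core 0)` and `𝒲₂.coreTF S₂ S₂.N ⊆ 𝒲₃.W (S₃.core 0)`.  Then `s = stepAF₃`, `T' = coreTF₃` on `Fin (S₁.N + 1 + S₂.N + 1 + S₃.N + 1)`
form a linked chain with constant source, `T' ⊆ T`, `KitsAt` at every step, excess `≤ η`, first level `𝒲₁.W (S₁.core 0)`, last true target `𝒲₃.coreTF S₃ S₃.N`.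
[cite: KozmaNitzan2024, §4 Lemma 11 (pp. 22–23), Lemma 12 (pp. 23–25), p. 20 (Step IV)] -/
theorem chain₃ (ho₂ : P₂.o = P₁.o) (ho₃ : P₃.o = P₁.o)
    (hRl₁ : P₁.Rlev + 1 ≤ S₁.R') (hRim₁ : ∀ k, P₁.Rim k ⊆ 𝒲₁.stepDF S₁ k) (hTne₁ : ∀ k ≤ S₁.N, (𝒲₁.coreTF S₁ k).Nonempty)
    (hRl₂ : P₂.Rlev + 1 ≤ S₂.R') (hRim₂ : ∀ k, P₂.Rim k ⊆ 𝒲₂.stepDF S₂ k) (hTne₂ : ∀ k ≤ S₂.N, (𝒲₂.coreTF S₂ k).Nonempty)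
    (hRl₃ : P₃.Rlev + 1 ≤ S₃.R') (hRim₃ : ∀ k, P₃.Rim k ⊆ 𝒲₃.stepDF S₃ k) (hTne₃ : ∀ k ≤ S₃.N, (𝒲₃.coreTF S₃ k).Nonempty)
    (hx₁₂ : 𝒲₁.coreTF S₁ S₁.N ⊆ 𝒲₂.W (S₂.core 0)) (hx₂₃ : 𝒲₂.coreTF S₂ S₂.N ⊆ 𝒲₃.W (S₃.core 0))
    {p : unitInterval} {W' : Sym2 V → unitInterval} {Δ' : ℕ} {δ η : ℝ}
    (hsub₁ : ∀ k ≤ S₁.N, IsSubbox G' W' p (𝒲₁.stepDF S₁ k)) (hfin₁ : FinSupp W' P₁.Sfin) (hDS₁ : ∀ k ≤ S₁.N, 𝒲₁.stepDF S₁ k ⊆ P₁.Sfin)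
    (ho₁ : ∀ k ≤ S₁.N, P₁.o ∉ 𝒲₁.stepDF S₁ k) (hoS₁ : P₁.o ∈ P₁.Sfin) (hj₁ : P₁.j₁ ≤ P₁.Rlev)
    (hcount₁ : 1 / (1 - (p : ℝ)) ^ (Δ' * P₁.N) ≤ δ * ((Finset.Icc P₁.j₀ P₁.j₁).card : ℝ))
    (hkits₁ : ∀ k ≤ S₁.N, ∀ j ∈ Finset.Icc P₁.j₀ P₁.j₁, ∃ (σ : SData V) (Sz : Finset V),
      SHyp (P₁.stepLF 𝒲₁ S₁ k) j σ ∧ σ.N ≤ P₁.N ∧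
      (1 - (p : ℝ) ^ σ.sB) ^ σ.k ≤ δ ∧ Sz ⊆ (P₁.stepLF 𝒲₁ S₁ k).X j ∧ Sz ⊆ 𝒲₁.stepDF S₁ k ∧
      (∀ x ∈ σ.K, ∀ e ∈ σ.seed x, e ∉ wireSet (↑Sz : Set V)) ∧ (∀ x ∈ σ.K, σ.face x ⊆ Sz) ∧
      (∀ x ∈ σ.K, 1 - 3 * δ ≤ (prodBernoulli W').real {ω | ∃ u ∈ σ.face x,
        1 - δ < (prodBernoulli (pinW W' (wireSet (↑Sz : Set V)) ω)).real
          (⋃ t ∈ P₁.coreEF 𝒲₁ S₁ k, openConnIn (↑(𝒲₁.stepDF S₁ k) : Set V) u t)}))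
    (hexc₁ : ∀ k ≤ S₁.N, (prodBernoulli W').real (⋃ t ∈ P₁.Rim k, openConn P₁.o t) ≤ η)
    (hsub₂ : ∀ k ≤ S₂.N, IsSubbox G' W' p (𝒲₂.stepDF S₂ k)) (hfin₂ : FinSupp W' P₂.Sfin) (hDS₂ : ∀ k ≤ S₂.N, 𝒲₂.stepDF S₂ k ⊆ P₂.Sfin)
    (ho₂' : ∀ k ≤ S₂.N, P₂.o ∉ 𝒲₂.stepDF S₂ k) (hoS₂ : P₂.o ∈ P₂.Sfin) (hj₂ : P₂.j₁ ≤ P₂.Rlev)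
    (hcount₂ : 1 / (1 - (p : ℝ)) ^ (Δ' * P₂.N) ≤ δ * ((Finset.Icc P₂.j₀ P₂.j₁).card : ℝ))
    (hkits₂ : ∀ k ≤ S₂.N, ∀ j ∈ Finset.Icc P₂.j₀ P₂.j₁, ∃ (σ : SData V) (Sz : Finset V),
      SHyp (P₂.stepLF 𝒲₂ S₂ k) j σ ∧ σ.N ≤ P₂.N ∧
      (1 - (p : ℝ) ^ σ.sB) ^ σ.k ≤ δ ∧ Sz ⊆ (P₂.stepLF 𝒲₂ S₂ k).X j ∧ Sz ⊆ 𝒲₂.stepDF S₂ k ∧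
      (∀ x ∈ σ.K, ∀ e ∈ σ.seed x, e ∉ wireSet (↑Sz : Set V)) ∧ (∀ x ∈ σ.K, σ.face x ⊆ Sz) ∧
      (∀ x ∈ σ.K, 1 - 3 * δ ≤ (prodBernoulli W').real {ω | ∃ u ∈ σ.face x,
        1 - δ < (prodBernoulli (pinW W' (wireSet (↑Sz : Set V)) ω)).real
          (⋃ t ∈ P₂.coreEF 𝒲₂ S₂ k, openConnIn (↑(𝒲₂.stepDF S₂ k) : Set V) u t)}))
    (hexc₂ : ∀ k ≤ S₂.N, (prodBernoulli W').real (⋃ t ∈ P₂.Rim k, openConn P₁.o t) ≤ η)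
    (hsub₃ : ∀ k ≤ S₃.N, IsSubbox G' W' p (𝒲₃.stepDF S₃ k)) (hfin₃ : FinSupp W' P₃.Sfin) (hDS₃ : ∀ k ≤ S₃.N, 𝒲₃.stepDF S₃ k ⊆ P₃.Sfin)
    (ho₃' : ∀ k ≤ S₃.N, P₃.o ∉ 𝒲₃.stepDF S₃ k) (hoS₃ : P₃.o ∈ P₃.Sfin) (hj₃ : P₃.j₁ ≤ P₃.Rlev)
    (hcount₃ : 1 / (1 - (p : ℝ)) ^ (Δ' * P₃.N) ≤ δ * ((Finset.Icc P₃.j₀ P₃.j₁).card : ℝ))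
    (hkits₃ : ∀ k ≤ S₃.N, ∀ j ∈ Finset.Icc P₃.j₀ P₃.j₁, ∃ (σ : SData V) (Sz : Finset V),
      SHyp (P₃.stepLF 𝒲₃ S₃ k) j σ ∧ σ.N ≤ P₃.N ∧
      (1 - (p : ℝ) ^ σ.sB) ^ σ.k ≤ δ ∧ Sz ⊆ (P₃.stepLF 𝒲₃ S₃ k).X j ∧ Sz ⊆ 𝒲₃.stepDF S₃ k ∧
      (∀ x ∈ σ.K, ∀ e ∈ σ.seed x, e ∉ wireSet (↑Sz : Set V)) ∧ (∀ x ∈ σ.K, σ.face x ⊆ Sz) ∧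
      (∀ x ∈ σ.K, 1 - 3 * δ ≤ (prodBernoulli W').real {ω | ∃ u ∈ σ.face x,
        1 - δ < (prodBernoulli (pinW W' (wireSet (↑Sz : Set V)) ω)).real
          (⋃ t ∈ P₃.coreEF 𝒲₃ S₃ k, openConnIn (↑(𝒲₃.stepDF S₃ k) : Set V) u t)}))
    (hexc₃ : ∀ k ≤ S₃.N, (prodBernoulli W').real (⋃ t ∈ P₃.Rim k, openConn P₁.o t) ≤ η) :
    let n := S₁.N + 1 + S₂.N + 1 + S₃.N
    let s : Fin (n + 1) → TStep G' := fun i => stepAF₃ P₁ P₂ P₃ 𝒲₁ 𝒲₂ 𝒲₃ S₁ S₂ S₃ i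
    let T' : Fin (n + 1) → Finset V := fun i => coreTF₃ 𝒲₁ 𝒲₂ 𝒲₃ S₁ S₂ S₃ i
    (∀ i : Fin (n + 1), (s i).L.o = P₁.o) ∧
    (∀ i : Fin n, T' (Fin.castSucc i) ⊆ (s i.succ).L.X 0) ∧ (∀ i : Fin (n + 1), T' i ⊆ (s i).T) ∧
    (∀ i : Fin (n + 1), (s i).KitsAt W' p Δ' δ) ∧
    (∀ i : Fin (n + 1), (prodBernoulli W').real (⋃ t ∈ (s i).T \ T' i, openConn P₁.o t) ≤ η) ∧
    (s 0).L.X 0 = 𝒲₁.W (S₁.core 0) ∧ T' (Fin.last n) = 𝒲₃.coreTF S₃ S₃.N := by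
  intro n s T'
  -- segments 1–2 glued by `chain₂`
  have h12 := chain₂ P₁ P₂ 𝒲₁ 𝒲₂ S₁ S₂ ho₂ hRl₁ hRim₁ hTne₁ hRl₂ hRim₂ hTne₂ hx₁₂ (p := p) (W' := W') (Δ' := Δ') (δ := δ) (η := η)
    hsub₁ hfin₁ hDS₁ ho₁ hoS₁ hj₁ hcount₁ hkits₁ hexc₁ hsub₂ hfin₂ hDS₂ ho₂' hoS₂ hj₂ hcount₂ hkits₂ hexc₂
  obtain ⟨-, hl12, hsub12, hkits12, hexc12, h012, hlast12⟩ := h12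
  -- per natural index: the step and target families and their facts, by cases at the second cut
  have hfacts : ∀ k ≤ n, coreTF₃ 𝒲₁ 𝒲₂ 𝒲₃ S₁ S₂ S₃ k ⊆ (stepAF₃ P₁ P₂ P₃ 𝒲₁ 𝒲₂ 𝒲₃ S₁ S₂ S₃ k).T ∧
      (stepAF₃ P₁ P₂ P₃ 𝒲₁ 𝒲₂ 𝒲₃ S₁ S₂ S₃ k).KitsAt W' p Δ' δ ∧
      (prodBernoulli W').real (⋃ t ∈ (stepAF₃ P₁ P₂ P₃ 𝒲₁ 𝒲₂ 𝒲₃ S₁ S₂ S₃ k).T \ coreTF₃ 𝒲₁ 𝒲₂ 𝒲₃ S₁ S₂ S₃ k, openConn P₁.o t) ≤ η := by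
    intro k hk
    by_cases h : k ≤ S₁.N + 1 + S₂.N
    · rw [stepAF₃_left _ _ _ _ _ _ _ _ _ h, coreTF₃_left _ _ _ _ _ _ h]
      exact ⟨hsub12 ⟨k, Nat.lt_succ_of_le h⟩, hkits12 ⟨k, Nat.lt_succ_of_le h⟩, hexc12 ⟨k, Nat.lt_succ_of_le h⟩⟩
    · obtain ⟨j, rfl⟩ : ∃ j, k = S₁.N + 1 + S₂.N + 1 + j := ⟨k - (S₁.N + 1 + S₂.N + 1), by omega⟩
      have hj : j ≤ S₃.N := by change S₁.N + 1 + S₂.N + 1 + j ≤ S₁.N + 1 + S₂.N + 1 + S₃.N at hk; omega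
      rw [stepAF₃_right, coreTF₃_right]
      refine ⟨P₃.coreTF_subset_coreEF 𝒲₃ S₃ j, P₃.kitsAt_stepAF 𝒲₃ S₃ hRl₃ hRim₃ hj (hTne₃ j hj) (hsub₃ j hj) hfin₃ (hDS₃ j hj) (ho₃' j hj) hoS₃ hj₃
        hcount₃ (hkits₃ j hj), ?_⟩
      refine le_trans (measureReal_mono ?_ (measure_ne_top _ _)) (hexc₃ j hj)
      intro ω hω
      simp only [Set.mem_iUnion, exists_prop] at hω ⊢
      obtain ⟨t, ht, hωt⟩ := hω
      exact ⟨t, P₃.coreEF_sdiff_subset 𝒲₃ S₃ j ht, hωt⟩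
  -- the links, by cases: inside segments 1–2 (by `chain₂`), at the second frame change, inside segment 3
  have hlinks : ∀ k, k + 1 ≤ n → coreTF₃ 𝒲₁ 𝒲₂ 𝒲₃ S₁ S₂ S₃ k ⊆ (stepAF₃ P₁ P₂ P₃ 𝒲₁ 𝒲₂ 𝒲₃ S₁ S₂ S₃ (k + 1)).L.X 0 := by
    intro k hk
    by_cases h : k + 1 ≤ S₁.N + 1 + S₂.N
    · rw [coreTF₃_left _ _ _ _ _ _ (by omega), stepAF₃_left _ _ _ _ _ _ _ _ _ h]
      exact hl12 ⟨k, by omega⟩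
    · by_cases h' : k = S₁.N + 1 + S₂.N
      · subst h'
        rw [coreTF₃_left _ _ _ _ _ _ le_rfl, coreTF₂_right, show S₁.N + 1 + S₂.N + 1 = S₁.N + 1 + S₂.N + 1 + 0 by omega, stepAF₃_right]
        show 𝒲₂.coreTF S₂ S₂.N ⊆ (P₃.stepLF 𝒲₃ S₃ 0).X 0
        rw [P₃.stepLF_X_zero 𝒲₃ S₃]
        exact hx₂₃
      · obtain ⟨j, rfl⟩ : ∃ j, k = S₁.N + 1 + S₂.N + 1 + j := ⟨k - (S₁.N + 1 + S₂.N + 1), by omega⟩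
        rw [coreTF₃_right, show S₁.N + 1 + S₂.N + 1 + j + 1 = S₁.N + 1 + S₂.N + 1 + (j + 1) by omega, stepAF₃_right]
        exact P₃.coreTF_subset_X_zero_succ 𝒲₃ S₃ j
  have hle : ∀ i : Fin (n + 1), (i : ℕ) ≤ n := fun i => Nat.lt_succ_iff.1 i.2
  refine ⟨fun i => stepAF₃_o P₁ P₂ P₃ 𝒲₁ 𝒲₂ 𝒲₃ S₁ S₂ S₃ ho₂ ho₃ i, fun i => ?_, fun i => (hfacts i (hle i)).1, fun i => (hfacts i (hle i)).2.1,
    fun i => (hfacts i (hle i)).2.2, ?_, ?_⟩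
  · -- the links
    show coreTF₃ 𝒲₁ 𝒲₂ 𝒲₃ S₁ S₂ S₃ (Fin.castSucc i) ⊆ (stepAF₃ P₁ P₂ P₃ 𝒲₁ 𝒲₂ 𝒲₃ S₁ S₂ S₃ (i.succ : ℕ)).L.X 0
    have e : ((i.succ : Fin (n + 1)) : ℕ) = (Fin.castSucc i : ℕ) + 1 := by simp
    rw [e]
    exact hlinks _ (by have := i.2; simp only [Fin.val_castSucc]; omega)
  · -- the first level is the window over the first core of segment 1
    show (stepAF₃ P₁ P₂ P₃ 𝒲₁ 𝒲₂ 𝒲₃ S₁ S₂ S₃ ((0 : Fin (n + 1)) : ℕ)).L.X 0 = 𝒲₁.W (S₁.core 0)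
    rw [Fin.val_zero, stepAF₃_left _ _ _ _ _ _ _ _ _ (Nat.zero_le _)]
    have h0 : (stepAF₂ P₁ P₂ 𝒲₁ 𝒲₂ S₁ S₂ ((0 : Fin (S₁.N + 1 + S₂.N + 1)) : ℕ)).L.X 0 = 𝒲₁.W (S₁.core 0) := h012
    rwa [Fin.val_zero] at h0
  · -- the last true target is the last one of segment 3
    show coreTF₃ 𝒲₁ 𝒲₂ 𝒲₃ S₁ S₂ S₃ ((Fin.last n : Fin (n + 1)) : ℕ) = 𝒲₃.coreTF S₃ S₃.N
    rw [Fin.val_last, show n = S₁.N + 1 + S₂.N + 1 + S₃.N from rfl, coreTF₃_right]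

end WinChainData

end Skelφ

end Summit.CriticalPhenomena.PercolationContinuityZ3.Theorems.Transplant

end
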